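import Literature.NumberTheory.Sieve.PolynomialValuesSieveSequence
import Literature.NumberTheory.Sieve.SieveFrameworkUpperBound
import Literature.NumberTheory.Sieve.HeathBrownCubicFLSequencesA
import Literature.NumberTheory.Sieve.PolynomialCongruencesRoughAP
import Literature.NumberTheory.Sieve.BatemanHornLinearProofs
import Literature.NumberTheory.Sieve.PolymathSieveAsymptotics
import Literature.NumberTheory.Sieve.PolymathLcmSumsZeta
import HarnessLib

/-!
# The sieve count in the proof of Proposition 4.2 (almost primality), p. 15

Trunk AntSieve, tooling toward the named fact `Literature.NumberTheory.Sieve.weakDHL_three_two_of_GEH`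
(D. H. J. Polymath, Res. Math. Sci. 1:12 (2014) = arXiv:1407.4897, Theorem 3.2(xii)), here the
inner count `Σ_{**} 1` of the proof of Proposition 4.2, p. 15: "the inner sum `Σ_{**}` is over
`x ≤ n ≤ 2x` with `n = b (W)` and `n + h_j = 0 (d_j)` for each `j`, with `p((n+h_j)/d_j) ≥ R` for
each `j`. We bound the inner sum `Σ_{**} 1` using a Selberg sieve upper bound … the main term
contributes `≪ (d/φ(d))^k x/(dW) (log R)^{-k} ≪ 2^{Ω(d)} B^{-k} x/(dW)`. We see that this final
bound applies trivially if `Ω(d) ≫ log^{1/2} x`."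

We use the tree's beta-sieve upper bound `SieveSequence.sifted_le_of_dvd_primesProdBelow`
(dimension `k`) for the polynomial sequence `polyAPSeq` of the values of
`f_H = ∏_{h ∈ H} (X + h + M)` (`M = max |h|`) along the progression `n ≡ c (W d)`, in place of
the Selberg sieve of the source (any `k`-dimensional upper-bound sieve does).

* `tuplePoly H`, `polyRootCountMod_tuplePoly` (`ω_f(p) = ν_H(p)`), `hasSieveDimension_tuplePoly`;
* `AlmostPrimeSieve.count_le` — for `d_h < y = x^{1/(40k)}`:
  `#{x ≤ n ≤ 2x : n = b (W), d_h ∣ n + h, (n + h, P') = 1 ∀ h} ≤ C_k 2^{(k+1)Ω(d)} x/(B^k W d) + x^{1/2}`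
  with `P'` the primes `< R_d = y^{1/(Ω(d)+1)}` not dividing `W d`.

## References

* [Polymath8b2014] D. H. J. Polymath, Res. Math. Sci. 1 (2014), Art. 12 = arXiv:1407.4897,
  proof of Proposition 4.2, p. 15.
* [HalberstamRichert1974] H. Halberstam, H.-E. Richert, *Sieve Methods*, Thm 2.5 (upper bound
  sieve of dimension `κ`; tree: `SieveFrameworkUpperBound.lean`).
-/

noncomputable section

open Finset Real Polynomial Filter
open scoped ArithmeticFunction.Omega ArithmeticFunction.omega

namespace Literature.NumberTheory.Sieve

open scoped Classical

namespace AlmostPrimeSieve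

/-! ### The tuple polynomial and its root count -/

/-- `M = max_{h ∈ H} |h|` (`0` for `H = ∅`). [folklore] -/
def shiftM (H : Finset ℤ) : ℕ := H.sup fun h => h.natAbs

/-- `|h| ≤ M`. [folklore] -/
theorem natAbs_le_shiftM {H : Finset ℤ} {h : ℤ} (hh : h ∈ H) : h.natAbs ≤ shiftM H :=
  Finset.le_sup (f := fun h : ℤ => h.natAbs) hh

/-- `0 ≤ h + M`. [folklore] -/
theorem add_shiftM_nonneg {H : Finset ℤ} {h : ℤ} (hh : h ∈ H) : 0 ≤ h + shiftM H := by
  have h1 : (h.natAbs : ℤ) ≤ shiftM H := by exact_mod_cast natAbs_le_shiftM hh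
  have h2 : -h ≤ h.natAbs := by rw [← Int.abs_eq_natAbs]; exact neg_le_abs h
  linarith

/-- `f_H = ∏_{h ∈ H} (X + (h + M))`. [cite: Polymath8b2014, proof of Prop. 4.2, p. 15] -/
def tuplePoly (H : Finset ℤ) : ℤ[X] := ∏ h ∈ H, (X + C (h + (shiftM H : ℤ)))

/-- `f_H(n) = ∏ (n + h + M)`. [folklore] -/
theorem eval_tuplePoly (H : Finset ℤ) (n : ℤ) : (tuplePoly H).eval n = ∏ h ∈ H, (n + (h + shiftM H)) := by
  simp only [tuplePoly, eval_prod, eval_add, eval_X, eval_C]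

/-- `f_H(n) ≥ 1` for `n ≥ 1`. [folklore] -/
theorem one_le_eval_tuplePoly (H : Finset ℤ) {n : ℤ} (hn : 1 ≤ n) : 1 ≤ (tuplePoly H).eval n := by
  rw [eval_tuplePoly]
  exact Finset.one_le_prod fun h hh => by linarith [add_shiftM_nonneg hh]

/-- `f_H(n) ≤ (n + 2M)^k` for `n ≥ 1`. [folklore] -/
theorem eval_tuplePoly_le (H : Finset ℤ) {n : ℤ} (hn : 1 ≤ n) : (tuplePoly H).eval n ≤ (n + 2 * shiftM H) ^ H.card := by
  rw [eval_tuplePoly]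
  refine (Finset.prod_le_prod (fun h hh => by linarith [add_shiftM_nonneg hh]) (fun h hh => ?_)).trans_eq (by rw [Finset.prod_const])
  have h1 : (h.natAbs : ℤ) ≤ shiftM H := by exact_mod_cast natAbs_le_shiftM hh
  have h2 : h ≤ h.natAbs := by rw [← Int.abs_eq_natAbs]; exact le_abs_self h
  linarith

/-- `ω_{f_H}(p) = ν_H(p)` for primes `p`. [folklore] -/
theorem polyRootCountMod_tuplePoly (H : Finset ℤ) {p : ℕ} (hp : p.Prime) :
    polyRootCountMod ![tuplePoly H] p = tupleResidueCount H p := by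
  haveI : NeZero p := ⟨hp.ne_zero⟩
  set H' : Finset ℤ := H.image fun h => h + (shiftM H : ℤ) with hH'
  -- `ω_{f_H} = ω` of the linear system attached to `H'`
  have h1 : polyRootCountMod ![tuplePoly H] p = polyRootCountMod (fun h : H' => (X + C (h : ℤ) : ℤ[X])) p := by
    rw [polyRootCountMod_single, polyRootCountMod]
    congr 1
    ext n
    simp only [Finset.mem_filter, Finset.mem_range, and_congr_right_iff]
    intro _
    rw [eval_tuplePoly, Finset.prod_coe_sort H' (fun h : ℤ => ((X + C h : ℤ[X])).eval (n : ℤ))]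
    simp only [eval_add, eval_X, eval_C, hH']
    rw [Finset.prod_image fun a _ b _ h => by simpa using h]
  rw [h1, polyRootCountMod_linear_eq_tupleResidueCount_holds H' hp]
  -- translation invariance of `ν`
  simp only [tupleResidueCount, hH', Finset.image_image]
  have : (fun h : ℤ => ((h : ℤ) : ZMod p)) ∘ (fun h : ℤ => h + (shiftM H : ℤ)) =
      (fun t : ZMod p => t + (shiftM H : ZMod p)) ∘ fun h : ℤ => (h : ZMod p) := by
    funext h; simp
  rw [this, ← Finset.image_image, Finset.card_image_of_injective _ (add_left_injective _)]

/-- `ω_{f_H}(p) ≤ k` and, for admissible `H`, `ω_{f_H}(p) ≤ p - 1`. [folklore] -/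
theorem polyRootCountMod_tuplePoly_le (H : Finset ℤ) {p : ℕ} (hp : p.Prime) :
    polyRootCountMod ![tuplePoly H] p ≤ H.card := by
  rw [polyRootCountMod_tuplePoly H hp]; exact tupleResidueCount_le_card H p

/-- Admissibility: `ω_{f_H}(p) < p`. [folklore] -/
theorem polyRootCountMod_tuplePoly_lt {H : Finset ℤ} (hH : IsAdmissibleTuple H) {p : ℕ} (hp : p.Prime) :
    polyRootCountMod ![tuplePoly H] p < p := by
  rw [polyRootCountMod_tuplePoly H hp]; exact hH p hp

/-- For `p` exceeding the diameter of `H`, `ω_{f_H}(p) = k`. [folklore] -/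
theorem polyRootCountMod_tuplePoly_eq {H : Finset ℤ} {p : ℕ} (hp : p.Prime) (hdiam : ∀ a ∈ H, ∀ b ∈ H, |a - b| < p) :
    polyRootCountMod ![tuplePoly H] p = H.card := by
  rw [polyRootCountMod_tuplePoly H hp]; exact tupleResidueCount_eq_card_of_lt_holds H p hdiam

/-- The sieve-dimension constant for `k`-tuples. [folklore] -/
def dimConstK (k : ℕ) : ℝ := Real.exp (k * (9 / 2 + 6 / Real.log 2) + (k : ℝ) ^ 2 / (1 / (2 * k)))

/-- **The density `ω_{f_H}(m)/m` has sieve dimension `k`** (admissible `H`, `k = #H ≥ 1`):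
`g(p) ≤ k/p` and `g(p) ≤ 1 - 1/(2k)`. [folklore] -/
theorem hasSieveDimension_tuplePoly {H : Finset ℤ} (hH : IsAdmissibleTuple H) (hk : 1 ≤ H.card) :
    HasSieveDimension (rootDensity (tuplePoly H)) H.card (dimConstK H.card) := by
  have hδ : (0 : ℝ) < 1 / (2 * H.card) := by positivity
  have h := CubicSieve.hasSieveDimension_of_le_div (g := rootDensity (tuplePoly H)) (A := H.card) hδ fun p hp => ?_
  · exact h
  have hp0 : (0 : ℝ) < p := by exact_mod_cast hp.pos
  refine ⟨rootDensity_nonneg _ _, ?_, ?_⟩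
  · rw [rootDensity_apply]
    exact div_le_div_of_nonneg_right (by exact_mod_cast polyRootCountMod_tuplePoly_le H hp) hp0.le
  · rw [rootDensity_apply]
    have hlt := polyRootCountMod_tuplePoly_lt hH hp
    have hle := polyRootCountMod_tuplePoly_le H hp
    rcases le_or_gt (2 * H.card) p with h2 | h2
    · -- `ω/p ≤ k/p ≤ 1/2 ≤ 1 - 1/(2k)`
      have hk1 : (1 : ℝ) ≤ H.card := by exact_mod_cast hk
      have : (polyRootCountMod ![tuplePoly H] p : ℝ) / p ≤ 1 / 2 := by
        rw [div_le_iff₀ hp0]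
        have : (2 * H.card : ℝ) ≤ p := by exact_mod_cast h2
        have : (polyRootCountMod ![tuplePoly H] p : ℝ) ≤ H.card := by exact_mod_cast hle
        linarith
      have h4 : 1 / (2 * (H.card : ℝ)) ≤ 1 / 2 :=
        one_div_le_one_div_of_le (by norm_num) (by linarith)
      linarith
    · -- `ω ≤ p - 1`, so `ω/p ≤ 1 - 1/p ≤ 1 - 1/(2k)`
      have h3 : (polyRootCountMod ![tuplePoly H] p : ℝ) ≤ p - 1 := by
        have : polyRootCountMod ![tuplePoly H] p + 1 ≤ p := hlt
        have : ((polyRootCountMod ![tuplePoly H] p + 1 : ℕ) : ℝ) ≤ p := by exact_mod_cast this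
        push_cast at this; linarith
      have h4 : 1 / (2 * (H.card : ℝ)) ≤ 1 / p :=
        one_div_le_one_div_of_le hp0 (by exact_mod_cast h2.le)
      calc (polyRootCountMod ![tuplePoly H] p : ℝ) / p ≤ (p - 1) / p := div_le_div_of_nonneg_right h3 hp0.le
        _ = 1 - 1 / p := by field_simp
        _ ≤ 1 - 1 / (2 * H.card) := by linarith

/-! ### The local densities: `φ(W)/W` (tree: `LcmEuler.totient_div_eq_prod`) and Mertens -/

/-- The Mertens constant `C₀ = 4 e^{6/log 2} log 2` of `prod_primesBelow_one_sub_inv_le`. [folklore] -/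
def mertensC₀ : ℝ := 4 * Real.exp (6 / Real.log 2) * Real.log 2

/-- `C₀ > 0`. [folklore] -/
theorem mertensC₀_pos : 0 < mertensC₀ := by
  unfold mertensC₀; have := Real.log_pos (by norm_num : (1:ℝ) < 2); positivity

/-- Bernoulli: `1 - k/p ≤ (1 - 1/p)^k` for `p ≥ 1`. [folklore] -/
theorem one_sub_div_le_pow (k : ℕ) {p : ℝ} (hp : 1 ≤ p) : 1 - (k : ℝ) / p ≤ (1 - p⁻¹) ^ k := by
  have h2 : (-2 : ℝ) ≤ -p⁻¹ := by
    have : p⁻¹ ≤ 1 := inv_le_one_of_one_le₀ hp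
    linarith
  calc 1 - (k : ℝ) / p = 1 + k * (-p⁻¹) := by rw [div_eq_mul_inv]; ring
    _ ≤ (1 + -p⁻¹) ^ k := one_add_mul_le_pow h2 k
    _ = (1 - p⁻¹) ^ k := by rw [← sub_eq_add_neg]

/-- **The product over the sifting primes**: if every prime factor of `W ≠ 0` is `< R`, `R ≥ 3`, every
prime `p ∤ W` satisfies `2k < p` and `ω(p) = k`, then for the primes `p < R` with `p ∤ W D` (`D ≠ 0`):
`∏ (1 - ω(p)/p) ≤ 2^{ω(D)} ((W/φ(W)) C₀ / log R)^k`. [cite: Polymath8b2014, proof of Prop. 4.2, p. 15] -/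
theorem prod_sifting_le {k : ℕ} {W D : ℕ} (hW : W ≠ 0) (hD : D ≠ 0) {R : ℝ} (hR : 3 ≤ R)
    (hWR : ∀ p ∈ W.primeFactors, (p : ℝ) < R) (ω' : ℕ → ℕ)
    (hω : ∀ p : ℕ, p.Prime → ¬ p ∣ W → 2 * k < p ∧ ω' p = k) :
    ∏ p ∈ (Nat.primesBelow ⌈R⌉₊).filter (fun p => ¬ p ∣ W * D), (1 - (ω' p : ℝ) / p) ≤
      2 ^ ω D * (((W : ℝ) / Nat.totient W) * mertensC₀ / Real.log R) ^ k := by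
  set P₁ := Nat.primesBelow ⌈R⌉₊ with hP₁
  set U := P₁.filter (fun p => ¬ p ∣ W) with hU
  have hmemP₁ : ∀ p ∈ P₁, p.Prime ∧ (p : ℝ) < R := fun p hp => by
    rw [hP₁, Nat.mem_primesBelow] at hp; exact ⟨hp.2, Nat.lt_ceil.1 hp.1⟩
  have hmemU : ∀ p ∈ U, p.Prime ∧ ¬ p ∣ W ∧ 2 * k < p ∧ ω' p = k := fun p hp => by
    obtain ⟨hp1, hp2⟩ := Finset.mem_filter.1 hp
    exact ⟨(hmemP₁ p hp1).1, hp2, hω p (hmemP₁ p hp1).1 hp2⟩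
  -- Step 1: the sifting set is `U` minus the primes dividing `D`
  have hsplit : (Nat.primesBelow ⌈R⌉₊).filter (fun p => ¬ p ∣ W * D) = U.filter (fun p => ¬ p ∣ D) := by
    ext p
    simp only [hU, Finset.mem_filter, and_assoc]
    constructor
    · rintro ⟨hp, hnd⟩
      exact ⟨hp, fun h => hnd (h.mul_right _), fun h => hnd (h.mul_left _)⟩
    · rintro ⟨hp, h1, h2⟩
      exact ⟨hp, fun h => by
        rcases (Nat.Prime.dvd_mul (hmemP₁ p hp).1).1 h with h | h
        · exact h1 h
        · exact h2 h⟩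
  rw [hsplit]
  -- Step 2: termwise facts on `U`
  have hfac : ∀ p ∈ U, (1 : ℝ) / 2 ≤ 1 - (ω' p : ℝ) / p ∧ 1 - (ω' p : ℝ) / p ≤ (1 - (p : ℝ)⁻¹) ^ k := by
    intro p hp
    obtain ⟨hpp, -, h2k, hωp⟩ := hmemU p hp
    have hp0 : (0 : ℝ) < p := by exact_mod_cast hpp.pos
    have h2k' : (2 * k : ℝ) < p := by exact_mod_cast h2k
    rw [hωp]
    refine ⟨?_, one_sub_div_le_pow k (by exact_mod_cast hpp.one_le)⟩
    have : (k : ℝ) / p ≤ 1 / 2 := by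
      rw [div_le_div_iff₀ hp0 (by norm_num)]; linarith
    linarith
  -- Step 3: `(1/2)^{ω(D)} ≤ ∏_{U, p ∣ D} (1 - k/p)`
  have hprodD : ((1 : ℝ) / 2) ^ ω D ≤ ∏ p ∈ U.filter (fun p => p ∣ D), (1 - (ω' p : ℝ) / p) := by
    have hcard : (U.filter (fun p => p ∣ D)).card ≤ ω D := by
      rw [ArithmeticFunction.cardDistinctFactors_apply, ← List.card_toFinset, Nat.toFinset_factors]
      refine Finset.card_le_card fun p hp => ?_
      obtain ⟨hpU, hpD⟩ := Finset.mem_filter.1 hp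
      exact Nat.mem_primeFactors.2 ⟨(hmemU p hpU).1, hpD, hD⟩
    calc ((1 : ℝ) / 2) ^ ω D ≤ ((1 : ℝ) / 2) ^ (U.filter (fun p => p ∣ D)).card :=
          pow_le_pow_of_le_one (by norm_num) (by norm_num) hcard
      _ = ∏ _p ∈ U.filter (fun p => p ∣ D), (1 : ℝ) / 2 := by rw [Finset.prod_const]
      _ ≤ _ := Finset.prod_le_prod (fun _ _ => by norm_num) fun p hp => (hfac p (Finset.mem_filter.1 hp).1).1
  -- Step 4: `∏_{U, p ∤ D} ≤ 2^{ω(D)} ∏_U`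
  have hnonneg : ∀ p ∈ U, (0 : ℝ) ≤ 1 - (ω' p : ℝ) / p := fun p hp => le_trans (by norm_num) (hfac p hp).1
  have hstep4 : ∏ p ∈ U.filter (fun p => ¬ p ∣ D), (1 - (ω' p : ℝ) / p) ≤ 2 ^ ω D * ∏ p ∈ U, (1 - (ω' p : ℝ) / p) := by
    rw [← Finset.prod_filter_mul_prod_filter_not U (fun p => p ∣ D)]
    have hA : 0 ≤ ∏ p ∈ U.filter (fun p => ¬ p ∣ D), (1 - (ω' p : ℝ) / p) :=
      Finset.prod_nonneg fun p hp => hnonneg p (Finset.mem_filter.1 hp).1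
    have h2 : (1 : ℝ) ≤ 2 ^ ω D * ∏ p ∈ U.filter (fun p => p ∣ D), (1 - (ω' p : ℝ) / p) := by
      calc (1 : ℝ) = 2 ^ ω D * (1 / 2) ^ ω D := by rw [← mul_pow]; norm_num
        _ ≤ _ := mul_le_mul_of_nonneg_left hprodD (by positivity)
    calc ∏ p ∈ U.filter (fun p => ¬ p ∣ D), (1 - (ω' p : ℝ) / p)
        = 1 * ∏ p ∈ U.filter (fun p => ¬ p ∣ D), (1 - (ω' p : ℝ) / p) := (one_mul _).symm
      _ ≤ (2 ^ ω D * ∏ p ∈ U.filter (fun p => p ∣ D), (1 - (ω' p : ℝ) / p)) *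
            ∏ p ∈ U.filter (fun p => ¬ p ∣ D), (1 - (ω' p : ℝ) / p) := mul_le_mul_of_nonneg_right h2 hA
      _ = _ := by ring
  -- Step 5: `∏_U (1 - k/p) ≤ (∏_U (1 - 1/p))^k` and `∏_U (1 - 1/p) = (W/φ(W)) ∏_{p < R} (1 - 1/p)`
  have hstep5 : ∏ p ∈ U, (1 - (ω' p : ℝ) / p) ≤ (∏ p ∈ U, (1 - (p : ℝ)⁻¹)) ^ k := by
    rw [← Finset.prod_pow]
    exact Finset.prod_le_prod hnonneg fun p hp => (hfac p hp).2
  have hWfac : P₁.filter (fun p => p ∣ W) = W.primeFactors := by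
    ext p
    simp only [Finset.mem_filter, hP₁, Nat.mem_primesBelow, Nat.mem_primeFactors, Nat.lt_ceil]
    constructor
    · rintro ⟨⟨-, hp⟩, hd⟩; exact ⟨hp, hd, hW⟩
    · rintro ⟨hp, hd, -⟩; exact ⟨⟨hWR p (Nat.mem_primeFactors.2 ⟨hp, hd, hW⟩), hp⟩, hd⟩
  have hphi : ∏ p ∈ P₁.filter (fun p => p ∣ W), (1 - (p : ℝ)⁻¹) = (Nat.totient W : ℝ) / W := by
    rw [hWfac, LcmEuler.totient_div_eq_prod hW]
  have hphipos : (0 : ℝ) < (Nat.totient W : ℝ) / W :=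
    div_pos (by exact_mod_cast Nat.totient_pos.2 (Nat.pos_of_ne_zero hW)) (by exact_mod_cast Nat.pos_of_ne_zero hW)
  have hUprod : ∏ p ∈ U, (1 - (p : ℝ)⁻¹) = ((W : ℝ) / Nat.totient W) * ∏ p ∈ P₁, (1 - (p : ℝ)⁻¹) := by
    have h := Finset.prod_filter_mul_prod_filter_not P₁ (fun p => p ∣ W) (f := fun p => 1 - (p : ℝ)⁻¹)
    rw [hphi] at h
    rw [← h, ← mul_assoc, div_mul_div_cancel₀', div_self, one_mul] <;> first
      | exact_mod_cast (Nat.totient_pos.2 (Nat.pos_of_ne_zero hW)).ne'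
      | skip
    exact_mod_cast (Nat.pos_of_ne_zero hW).ne'
  have hMertens : ∏ p ∈ P₁, (1 - (p : ℝ)⁻¹) ≤ mertensC₀ / Real.log R := prod_primesBelow_one_sub_inv_le hR
  have hUpos : 0 ≤ ∏ p ∈ U, (1 - (p : ℝ)⁻¹) :=
    Finset.prod_nonneg fun p hp => sub_nonneg.2 (inv_le_one_of_one_le₀ (by exact_mod_cast (hmemU p hp).1.one_le))
  calc ∏ p ∈ U.filter (fun p => ¬ p ∣ D), (1 - (ω' p : ℝ) / p)
      ≤ 2 ^ ω D * ∏ p ∈ U, (1 - (ω' p : ℝ) / p) := hstep4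
    _ ≤ 2 ^ ω D * (∏ p ∈ U, (1 - (p : ℝ)⁻¹)) ^ k := mul_le_mul_of_nonneg_left hstep5 (by positivity)
    _ ≤ 2 ^ ω D * (((W : ℝ) / Nat.totient W) * mertensC₀ / Real.log R) ^ k := by
        refine mul_le_mul_of_nonneg_left (pow_le_pow_left₀ hUpos ?_ k) (by positivity)
        rw [hUprod, mul_div_assoc]
        exact mul_le_mul_of_nonneg_left hMertens (by positivity)

/-! ### The counted set and its reduction to one residue class -/

section Count

variable {H : Finset ℤ} {x : ℝ} {b : ℤ} {d : ℤ → ℕ}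

/-- The inner count `Σ_{**} 1` of the proof of Proposition 4.2: the `n` of the summation range with
`d_h ∣ n + h` for all `h` and no prime `p < R`, `p ∤ W ∏ d_h`, dividing any `n + h`. [cite: Polymath8b2014, proof of Prop. 4.2, p. 15] -/
def cnt (H : Finset ℤ) (x : ℝ) (b : ℤ) (d : ℤ → ℕ) (R : ℝ) : Finset ℕ :=
  (polymathRange x b).filter fun n => (∀ h ∈ H, (d h : ℤ) ∣ (n : ℤ) + h) ∧
    ∀ p : ℕ, p.Prime → (p : ℝ) < R → ¬ p ∣ polymathW x * ∏ h ∈ H, d h → ∀ h ∈ H, ¬ ((p : ℤ) ∣ (n : ℤ) + h)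

/-- Membership in `cnt`. [folklore] -/
theorem mem_cnt {R : ℝ} {n : ℕ} : n ∈ cnt H x b d R ↔ n ∈ polymathRange x b ∧ (∀ h ∈ H, (d h : ℤ) ∣ (n : ℤ) + h) ∧
    ∀ p : ℕ, p.Prime → (p : ℝ) < R → ¬ p ∣ polymathW x * ∏ h ∈ H, d h → ∀ h ∈ H, ¬ ((p : ℤ) ∣ (n : ℤ) + h) := by
  rw [cnt, Finset.mem_filter]

/-- A member forces `(d_h, W) = 1`. [cite: Polymath8b2014, proof of Prop. 4.2, p. 15] -/
theorem coprime_W_of_mem (hb : ∀ h ∈ H, IsCoprime (b + h) (polymathW x)) {R : ℝ} {n₀ : ℕ} (hn₀ : n₀ ∈ cnt H x b d R)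
    {h : ℤ} (hh : h ∈ H) : (d h).Coprime (polymathW x) := by
  rw [mem_cnt] at hn₀
  obtain ⟨hrange, hdvd, -⟩ := hn₀
  have hmod : (n₀ : ℤ) ≡ b [ZMOD (polymathW x : ℤ)] := (Finset.mem_filter.1 hrange).2
  refine Nat.coprime_of_dvd fun p hp hpd hpW => ?_
  have h1 : (p : ℤ) ∣ (n₀ : ℤ) + h := (Int.natCast_dvd_natCast.2 hpd).trans (hdvd h hh)
  have h2 : (p : ℤ) ∣ b - n₀ := (Int.natCast_dvd_natCast.2 hpW).trans hmod.dvd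
  have h3 : (p : ℤ) ∣ b + h := by
    have : b + h = (n₀ : ℤ) + h + (b - n₀) := by ring
    rw [this]; exact dvd_add h1 h2
  have hunit := (hb h hh).isUnit_of_dvd' h3 (Int.natCast_dvd_natCast.2 hpW)
  rw [Int.isUnit_iff_natAbs_eq, Int.natAbs_natCast] at hunit
  exact hp.one_lt.ne' hunit

/-- A member forces the `d_h` to be pairwise coprime (primes `∤ W` exceed the diameter of `H`).
[cite: Polymath8b2014, proof of Prop. 4.2, p. 15] -/
theorem coprime_of_mem (hb : ∀ h ∈ H, IsCoprime (b + h) (polymathW x))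
    (hWd : ∀ p : ℕ, p.Prime → ¬ p ∣ polymathW x → ∀ a ∈ H, ∀ c ∈ H, |a - c| < p) {R : ℝ} {n₀ : ℕ}
    (hn₀ : n₀ ∈ cnt H x b d R) {h h' : ℤ} (hh : h ∈ H) (hh' : h' ∈ H) (hne : h ≠ h') : (d h).Coprime (d h') := by
  have hcopW := coprime_W_of_mem hb hn₀ hh
  rw [mem_cnt] at hn₀
  obtain ⟨-, hdvd, -⟩ := hn₀
  refine Nat.coprime_of_dvd fun p hp hp1 hp2 => ?_
  have hpW : ¬ p ∣ polymathW x := fun h => hp.one_lt.ne' (Nat.Coprime.eq_one_of_dvd (hcopW.coprime_dvd_left hp1) h)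
  have h1 : (p : ℤ) ∣ (n₀ : ℤ) + h := (Int.natCast_dvd_natCast.2 hp1).trans (hdvd h hh)
  have h2 : (p : ℤ) ∣ (n₀ : ℤ) + h' := (Int.natCast_dvd_natCast.2 hp2).trans (hdvd h' hh')
  have h3 : (p : ℤ) ∣ h - h' := by
    have : h - h' = ((n₀ : ℤ) + h) - ((n₀ : ℤ) + h') := by ring
    rw [this]; exact dvd_sub h1 h2
  have h4 := Int.eq_zero_of_abs_lt_dvd h3 (hWd p hp hpW h hh h' hh')
  exact hne (sub_eq_zero.1 h4)

/-- All members lie in one residue class modulo `q = W ∏ d_h`. [cite: Polymath8b2014, proof of Prop. 4.2, p. 15] -/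
theorem modEq_of_mem (hb : ∀ h ∈ H, IsCoprime (b + h) (polymathW x))
    (hWd : ∀ p : ℕ, p.Prime → ¬ p ∣ polymathW x → ∀ a ∈ H, ∀ c ∈ H, |a - c| < p) {R : ℝ} {n₀ n : ℕ}
    (hn₀ : n₀ ∈ cnt H x b d R) (hn : n ∈ cnt H x b d R) : n ≡ n₀ [MOD polymathW x * ∏ h ∈ H, d h] := by
  have hcopW : ∀ h ∈ H, (d h).Coprime (polymathW x) := fun h hh => coprime_W_of_mem hb hn₀ hh
  have hcop : ∀ h ∈ H, ∀ h' ∈ H, h ≠ h' → (d h).Coprime (d h') := fun h hh h' hh' hne => coprime_of_mem hb hWd hn₀ hh hh' hne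
  rw [mem_cnt] at hn₀ hn
  obtain ⟨hr₀, hd₀, -⟩ := hn₀
  obtain ⟨hr, hdn, -⟩ := hn
  have hm₀ : (n₀ : ℤ) ≡ b [ZMOD (polymathW x : ℤ)] := (Finset.mem_filter.1 hr₀).2
  have hm : (n : ℤ) ≡ b [ZMOD (polymathW x : ℤ)] := (Finset.mem_filter.1 hr).2
  rw [Nat.modEq_iff_dvd]
  push_cast
  have hW : ((polymathW x : ℕ) : ℤ) ∣ (n₀ : ℤ) - n := by
    have : (n₀ : ℤ) - n = (b - n) - (b - n₀) := by ring
    rw [this]; exact dvd_sub hm.dvd hm₀.dvd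
  have hD : (∏ h ∈ H, (d h : ℤ)) ∣ (n₀ : ℤ) - n := by
    refine Finset.prod_dvd_of_coprime (fun h hh h' hh' hne => Nat.isCoprime_iff_coprime.2 (hcop h hh h' hh' hne)) fun h hh => ?_
    have : (n₀ : ℤ) - n = ((n₀ : ℤ) + h) - ((n : ℤ) + h) := by ring
    rw [this]; exact dvd_sub (hd₀ h hh) (hdn h hh)
  have hcopWD : IsCoprime ((polymathW x : ℕ) : ℤ) (∏ h ∈ H, (d h : ℤ)) :=
    IsCoprime.prod_right fun h hh => Nat.isCoprime_iff_coprime.2 (hcopW h hh).symm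
  exact hcopWD.mul_dvd hW hD

/-- Members lie in the progression `apIndex ⌊2x⌋ q n₀`. [folklore] -/
theorem mem_apIndex_of_mem (hb : ∀ h ∈ H, IsCoprime (b + h) (polymathW x))
    (hWd : ∀ p : ℕ, p.Prime → ¬ p ∣ polymathW x → ∀ a ∈ H, ∀ c ∈ H, |a - c| < p) (hx : 1 ≤ x) {R : ℝ} {n₀ n : ℕ}
    (hn₀ : n₀ ∈ cnt H x b d R) (hn : n ∈ cnt H x b d R) : n ∈ apIndex ⌊2 * x⌋₊ (polymathW x * ∏ h ∈ H, d h) n₀ := by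
  have hmod := modEq_of_mem hb hWd hn₀ hn
  rw [mem_cnt] at hn
  have hIcc := Finset.mem_Icc.1 (Finset.mem_filter.1 hn.1).1
  rw [mem_apIndex]
  refine ⟨⟨?_, hIcc.2⟩, hmod⟩
  have : 1 ≤ ⌈x⌉₊ := Nat.one_le_iff_ne_zero.2 (by rw [Ne, Nat.ceil_eq_zero]; linarith)
  omega

end Count

/-! ### The count -/

/-- The constant of the count. [folklore] -/
def countConst (k : ℕ) : ℝ := max 2 ((1 + 2 * dimConstK k ^ (10 : ℕ)) * 2 * mertensC₀ ^ k * (40 * k) ^ k)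

/-- `countConst k ≥ 2`. [folklore] -/
theorem two_le_countConst (k : ℕ) : 2 ≤ countConst k := le_max_left _ _

/-- `ω(n) ≤ Ω(n)`. [folklore] -/
theorem cardDistinctFactors_le_cardFactors (n : ℕ) : ω n ≤ Ω n := by
  rw [ArithmeticFunction.cardDistinctFactors_apply, ArithmeticFunction.cardFactors_apply]
  exact (List.dedup_sublist _).length_le

set_option maxHeartbeats 800000 in
/-- **The sieve count `Σ_{**} 1`** (proof of Proposition 4.2, p. 15): for admissible `H` (`k = #H ≥ 1`),
`b` with `(b + h, W) = 1`, positive `d_h` (in the source `d_h < x^{1/10k}`; no size restriction is needed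
for the bound as stated), and `x` large in the sense of the listed hypotheses,
`#cnt ≤ C_k 2^{(k+1)Ω(d)} x/(B^k W d) + x^{1/2}` where `d = ∏ d_h` and the sifting level is
`R = x^{1/(40k(Ω(d)+1))}`. [cite: Polymath8b2014, proof of Prop. 4.2, p. 15] -/
theorem count_le {H : Finset ℤ} (hH : IsAdmissibleTuple H) (hk : 1 ≤ H.card) {x : ℝ} (hx1 : (shiftM H : ℝ) + 2 ≤ x)
    {b : ℤ} (hb : ∀ h ∈ H, IsCoprime (b + h) (polymathW x))
    (hWp : ∀ p : ℕ, p.Prime → ¬ p ∣ polymathW x → 2 * H.card < p ∧ ∀ a ∈ H, ∀ c ∈ H, |a - c| < p)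
    (hB : ∀ m : ℕ, (2 : ℝ) ^ m > Real.log x ∨ (3 ≤ x ^ (1 / (40 * (H.card : ℝ) * (m + 1))) ∧
      ∀ p ∈ (polymathW x).primeFactors, (p : ℝ) < x ^ (1 / (40 * (H.card : ℝ) * (m + 1)))))
    {d : ℤ → ℕ} (hd : ∀ h ∈ H, 0 < d h) :
    ((cnt H x b d (x ^ (1 / (40 * (H.card : ℝ) * (Ω (∏ h ∈ H, d h) + 1))))).card : ℝ) ≤
      countConst H.card * 2 ^ ((H.card + 1) * Ω (∏ h ∈ H, d h)) *
        (x / (polymathB x ^ H.card * polymathW x)) / ((∏ h ∈ H, d h : ℕ) : ℝ) + x ^ (1 / 2 : ℝ) := by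
  set k := H.card with hkdef
  set W := polymathW x with hWdef
  set D := ∏ h ∈ H, d h with hDdef
  set R := x ^ (1 / (40 * (k : ℝ) * (Ω D + 1))) with hRdef
  set S := cnt H x b d R with hSdef
  set X₀ := x / (polymathB x ^ k * W) with hX₀
  have hx0 : 0 < x := by linarith [Nat.cast_nonneg (α := ℝ) (shiftM H)]
  have hx1' : 1 ≤ x := by linarith [Nat.cast_nonneg (α := ℝ) (shiftM H)]
  have hxgt1 : 1 < x := by linarith [Nat.cast_nonneg (α := ℝ) (shiftM H)]
  have hBpos : 0 < polymathB x := polymathB_pos hxgt1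
  have hW0 : W ≠ 0 := (polymathW_pos x).ne'
  have hWpos : (0 : ℝ) < W := by exact_mod_cast polymathW_pos x
  have hD0 : D ≠ 0 := Finset.prod_ne_zero_iff.2 fun h hh => (hd h hh).ne'
  have hDpos : (0 : ℝ) < D := by exact_mod_cast Nat.pos_of_ne_zero hD0
  have hφpos : (0 : ℝ) < Nat.totient W := by exact_mod_cast totient_polymathW_pos x
  have hq0 : 0 < W * D := Nat.pos_of_ne_zero (mul_ne_zero hW0 hD0)
  have hX₀nn : 0 ≤ X₀ := by
    rw [hX₀]; refine div_nonneg hx0.le (mul_nonneg (pow_nonneg ?_ _) hWpos.le)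
    rw [polymathB]; exact mul_nonneg (div_nonneg hφpos.le hWpos.le) (Real.log_nonneg hx1')
  have hC2 := two_le_countConst k
  have hRHSnn : 0 ≤ countConst k * 2 ^ ((k + 1) * Ω D) * X₀ / D := by
    have : 0 ≤ countConst k := by linarith
    positivity
  have hsqrt : (1 : ℝ) ≤ x ^ (1 / 2 : ℝ) := Real.one_le_rpow hx1' (by norm_num)
  -- the empty case
  rcases S.eq_empty_or_nonempty with hS | ⟨n₀, hn₀⟩
  · rw [hS, Finset.card_empty, Nat.cast_zero]; linarith
  have hWd : ∀ p : ℕ, p.Prime → ¬ p ∣ polymathW x → ∀ a ∈ H, ∀ c ∈ H, |a - c| < p := fun p hp hpW => (hWp p hp hpW).2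
  -- all members are in one progression mod `q = W D`
  have hsub : S ⊆ apIndex ⌊2 * x⌋₊ (W * D) n₀ := fun n hn => mem_apIndex_of_mem hb hWd hx1' hn₀ hn
  have hcardA : (S.card : ℝ) ≤ 2 * x / (W * D) + 1 := by
    have hfl : (⌊2 * x⌋₊ : ℝ) ≤ 2 * x := Nat.floor_le (by linarith)
    calc (S.card : ℝ) ≤ (apIndex ⌊2 * x⌋₊ (W * D) n₀).card := by exact_mod_cast Finset.card_le_card hsub
      _ ≤ (⌊2 * x⌋₊ : ℝ) / (W * D : ℕ) + 1 := card_apIndex_le hq0 _ _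
      _ ≤ 2 * x / (W * D) + 1 := by
          push_cast
          have : (⌊2 * x⌋₊ : ℝ) / (↑W * ↑D) ≤ 2 * x / (↑W * ↑D) := div_le_div_of_nonneg_right hfl (by positivity)
          linarith
  -- `x/(W D) ≤ 2^{(k+1)Ω} X₀ / D` as soon as `B^k ≤ 2^{(k+1)Ω(D)}`
  have hBle : polymathB x ≤ Real.log x := by
    rw [polymathB]
    refine mul_le_of_le_one_left (Real.log_nonneg hx1') ?_
    rw [div_le_one hWpos]; exact_mod_cast Nat.totient_le W
  have hkey_of : polymathB x ^ k ≤ 2 ^ ((k + 1) * Ω D) → x / (W * D) ≤ 2 ^ ((k + 1) * Ω D) * X₀ / D := by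
    intro hBk
    have hxWD : 0 ≤ x / (↑W * ↑D) := by positivity
    have hid : (2 : ℝ) ^ ((k + 1) * Ω D) * X₀ / D = (2 ^ ((k + 1) * Ω D) / polymathB x ^ k) * (x / (W * D)) := by
      rw [hX₀]; field_simp
    rw [hid]
    refine le_mul_of_one_le_left hxWD ?_
    rw [le_div_iff₀ (pow_pos hBpos k), one_mul]; exact hBk
  have hfinal : ∀ c : ℝ, c ≤ countConst k → (S.card : ℝ) ≤ c * (2 ^ ((k + 1) * Ω D) * X₀ / D) + x ^ (1 / 2 : ℝ) →
      (S.card : ℝ) ≤ countConst k * 2 ^ ((k + 1) * Ω D) * X₀ / D + x ^ (1 / 2 : ℝ) := by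
    intro c hc h
    have h2 : c * (2 ^ ((k + 1) * Ω D) * X₀ / D) ≤ countConst k * (2 ^ ((k + 1) * Ω D) * X₀ / D) :=
      mul_le_mul_of_nonneg_right hc (by positivity)
    have : countConst k * 2 ^ ((k + 1) * Ω D) * X₀ / D = countConst k * (2 ^ ((k + 1) * Ω D) * X₀ / D) := by ring
    linarith
  rcases (hB (Ω D)) with hcaseA | ⟨hR3, hWR⟩
  · -- Case A: `log x < 2^{Ω(D)}`: the trivial bound suffices
    have hBk : polymathB x ^ k ≤ 2 ^ ((k + 1) * Ω D) := by
      calc polymathB x ^ k ≤ Real.log x ^ k := pow_le_pow_left₀ hBpos.le hBle k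
        _ ≤ ((2 : ℝ) ^ Ω D) ^ k := pow_le_pow_left₀ (Real.log_nonneg hx1') hcaseA.le k
        _ = 2 ^ (Ω D * k) := by rw [pow_mul]
        _ ≤ 2 ^ ((k + 1) * Ω D) := pow_le_pow_right₀ (by norm_num) (by nlinarith)
    have hkey := hkey_of hBk
    refine hfinal 2 hC2 ?_
    calc (S.card : ℝ) ≤ 2 * x / (W * D) + 1 := hcardA
      _ = 2 * (x / (W * D)) + 1 := by ring
      _ ≤ 2 * (2 ^ ((k + 1) * Ω D) * X₀ / D) + x ^ (1 / 2 : ℝ) := add_le_add (mul_le_mul_of_nonneg_left hkey (by norm_num)) hsqrt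
  · -- Case B: the sieve.  Notation.
    set f := tuplePoly H with hf
    set M := shiftM H with hM
    set N := ⌊2 * x⌋₊ with hN
    set q := W * D with hq
    set r := n₀ with hr
    set P₁ := Nat.primesBelow ⌈R⌉₊ with hP₁
    set P' := ∏ p ∈ P₁.filter (fun p => ¬ p ∣ q), p with hP'
    have hR0 : 0 < R := by linarith
    have hR1 : 1 < R := by linarith
    have hlogR : 0 < Real.log R := Real.log_pos hR1
    have hmemP₁ : ∀ p ∈ P₁, p.Prime ∧ (p : ℝ) < R := fun p hp => by
      rw [hP₁, Nat.mem_primesBelow] at hp; exact ⟨hp.2, Nat.lt_ceil.1 hp.1⟩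
    have hP'fac : P'.primeFactors = P₁.filter (fun p => ¬ p ∣ q) :=
      Nat.primeFactors_prod fun p hp => (hmemP₁ p (Finset.mem_filter.1 hp).1).1
    have hP'dvd : P' ∣ primesProdBelow R := Finset.prod_dvd_prod_of_subset _ _ _ (Finset.filter_subset _ _)
    have hP'0 : P' ≠ 0 := Finset.prod_ne_zero_iff.2 fun p hp => (hmemP₁ p (Finset.mem_filter.1 hp).1).1.ne_zero
    have hqP' : q.Coprime P' := by
      refine Nat.Coprime.prod_right fun p hp => ?_
      obtain ⟨hp1, hp2⟩ := Finset.mem_filter.1 hp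
      exact (Nat.coprime_comm.1 ((Nat.Prime.coprime_iff_not_dvd (hmemP₁ p hp1).1).2 hp2))
    -- Step B1: the injection `n ↦ n - M` into the sifted polynomial sequence
    have hMx : (M : ℝ) + 2 ≤ x := hx1
    set T := (apIndex N q (r - M)).filter (fun m : ℕ => (f.eval (m : ℤ)).natAbs.Coprime P') with hT
    have hST : S.card ≤ T.card := by
      refine Finset.card_le_card_of_injOn (fun n => n - M) (fun n hn => ?_) (fun n hn n' hn' h => ?_)
      · have hn' : n ∈ S := Finset.mem_coe.1 hn
        have hnA := hsub hn'
        rw [mem_apIndex] at hnA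
        obtain ⟨⟨hn0, hnN⟩, hmod⟩ := hnA
        have hnS := hn'
        rw [hSdef, mem_cnt] at hnS
        obtain ⟨hrange, -, hsieve⟩ := hnS
        have hxn : x ≤ n := (le_of_mem_polymathRange hx0.le hrange).1
        have hMn : M + 2 ≤ n := by
          have : (M : ℝ) + 2 ≤ n := hMx.trans hxn
          exact_mod_cast this
        have hn₀A := hsub hn₀
        rw [mem_apIndex] at hn₀A
        have hxn₀ : x ≤ n₀ := by
          have := hn₀; rw [hSdef, mem_cnt] at this
          exact (le_of_mem_polymathRange hx0.le this.1).1
        have hMn₀ : M + 2 ≤ n₀ := by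
          have : (M : ℝ) + 2 ≤ n₀ := hMx.trans hxn₀
          exact_mod_cast this
        show n - M ∈ (T : Set ℕ)
        rw [Finset.mem_coe, hT, Finset.mem_filter, mem_apIndex]
        refine ⟨⟨⟨by omega, le_trans (Nat.sub_le _ _) hnN⟩, ?_⟩, ?_⟩
        · -- `n - M ≡ n₀ - M`
          refine Nat.ModEq.add_right_cancel' M ?_
          rw [Nat.sub_add_cancel (by omega), hr, Nat.sub_add_cancel (by omega)]
          exact hmod
        · -- coprimality with `P'`
          refine Nat.Coprime.prod_right fun p hp => ?_
          obtain ⟨hp1, hpq⟩ := Finset.mem_filter.1 hp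
          obtain ⟨hpp, hpR⟩ := hmemP₁ p hp1
          rw [Nat.coprime_comm, Nat.Prime.coprime_iff_not_dvd hpp]
          intro hdvd
          have hdvd' : (p : ℤ) ∣ f.eval ((n - M : ℕ) : ℤ) := Int.natCast_dvd.2 hdvd
          rw [hf, eval_tuplePoly] at hdvd'
          have hcast : ((n - M : ℕ) : ℤ) = (n : ℤ) - M := by push_cast [Nat.cast_sub (show M ≤ n by omega)]; ring
          obtain ⟨h, hh, hph⟩ := (Prime.dvd_finsetProd_iff (Nat.prime_iff_prime_int.1 hpp) _).1 hdvd'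
          rw [hcast, ← hM, show (n : ℤ) - M + (h + M) = n + h by ring] at hph
          exact hsieve p hpp hpR (by rwa [hq] at hpq) h hh hph
      · -- injectivity
        have hmem : ∀ m : ℕ, m ∈ (S : Set ℕ) → M ≤ m := by
          intro m hm
          have hm' : m ∈ S := Finset.mem_coe.1 hm
          rw [hSdef, mem_cnt] at hm'
          have := (le_of_mem_polymathRange hx0.le hm'.1).1
          have : (M : ℝ) ≤ m := by linarith
          exact_mod_cast this
        exact (tsub_left_inj (hmem n hn) (hmem n' hn')).1 h
    -- Step B2: `#T` is the sifting function of the polynomial sequence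
    set A := polyAPSeq f N q (r - M) with hA
    set Xv : ℝ := ((((N : ℤ) + 2 * M) ^ k : ℤ) : ℝ) with hXv
    have hvals : ∀ m ∈ apIndex N q (r - M), 0 < f.eval (m : ℤ) ∧ ((f.eval (m : ℤ) : ℤ) : ℝ) ≤ Xv := by
      intro m hm
      rw [mem_apIndex] at hm
      have hm1 : (1 : ℤ) ≤ m := by exact_mod_cast hm.1.1
      refine ⟨lt_of_lt_of_le zero_lt_one (one_le_eval_tuplePoly H hm1), ?_⟩
      rw [hXv]
      have h1 := eval_tuplePoly_le H hm1
      have h2 : ((m : ℤ) + 2 * shiftM H) ^ H.card ≤ ((N : ℤ) + 2 * M) ^ k := by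
        rw [← hM, ← hkdef]
        exact pow_le_pow_left₀ (by positivity) (by have := hm.1.2; linarith [(by exact_mod_cast this : (m : ℤ) ≤ N)]) k
      exact_mod_cast h1.trans h2
    have hTcard : (T.card : ℝ) = A.sifted Xv P' := by rw [hA, polyAPSeq_sifted f N q (r - M) hvals P']
    -- Step B3: the upper-bound sieve
    have hdim : HasSieveDimension A.density (k : ℝ) (dimConstK k) := by
      rw [hA, polyAPSeq_density]; exact hasSieveDimension_tuplePoly hH hk
    have hκ : (0 : ℝ) < k := by exact_mod_cast hk
    set Dl : ℝ := R ^ (9 * k + 1) with hDl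
    have hDl1 : 1 < Dl := one_lt_pow₀ hR1 (by omega)
    have hzD : (9 * (k : ℝ) + 1) * Real.log R ≤ Real.log Dl := by
      rw [hDl, Real.log_pow]; push_cast; exact le_rfl
    have hsize : 0 ≤ A.size Xv := by rw [hA, polyAPSeq_size]; positivity
    have hsieve := SieveSequence.sifted_le_of_dvd_primesProdBelow hdim hκ (x := Xv) (by linarith : (2 : ℝ) ≤ R) hDl1 hzD hsize hP'dvd
    have hexp : Real.exp ((9 * (k : ℝ) + 1) - Real.log Dl / Real.log R) = 1 := by
      rw [hDl, Real.log_pow, mul_div_assoc, div_self hlogR.ne', mul_one]; push_cast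
      rw [sub_self, Real.exp_zero]
    rw [hexp, mul_one] at hsieve
    -- Step B4: the main term
    have hdens : A.densityProduct P' ≤ 2 ^ ω D * (((W : ℝ) / Nat.totient W) * mertensC₀ / Real.log R) ^ k := by
      rw [SieveSequence.densityProduct, hP'fac, hA, polyAPSeq_density]
      have h := prod_sifting_le (k := k) hW0 hD0 hR3 hWR (fun p => polyRootCountMod ![f] p) fun p hp hpW =>
        ⟨(hWp p hp hpW).1, by rw [hkdef]; exact polyRootCountMod_tuplePoly_eq hp (hWp p hp hpW).2⟩
      refine le_trans (le_of_eq (Finset.prod_congr rfl fun p _ => by rw [rootDensity_apply])) h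
    have hsizeq : A.size Xv = (N : ℝ) / q := by rw [hA, polyAPSeq_size]
    have hNle : (N : ℝ) ≤ 2 * x := Nat.floor_le (by linarith)
    have hlogRe : Real.log R = Real.log x / (40 * k * (Ω D + 1)) := by
      rw [hRdef, Real.log_rpow hx0]; ring
    have hmain : (1 + 2 * dimConstK k ^ (10 : ℕ)) * (A.size Xv * A.densityProduct P') ≤
        ((1 + 2 * dimConstK k ^ (10 : ℕ)) * 2 * mertensC₀ ^ k * (40 * k) ^ k) * (2 ^ ((k + 1) * Ω D) * X₀ / D) := by
      have hK : 0 ≤ 1 + 2 * dimConstK k ^ (10 : ℕ) := by have : 0 ≤ dimConstK k := (Real.exp_pos _).le; positivity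
      have hdens0 : 0 ≤ A.densityProduct P' := by
        rw [SieveSequence.densityProduct]
        exact Finset.prod_nonneg fun p hp => sub_nonneg.2 (by rw [hA, polyAPSeq_density]; exact rootDensity_le_one _ _)
      -- `size · V ≤ (2x/q) · 2^{ω} ((W/φ) C₀ / log R)^k`
      have h1 : A.size Xv * A.densityProduct P' ≤ (2 * x / q) * (2 ^ ω D * (((W : ℝ) / Nat.totient W) * mertensC₀ / Real.log R) ^ k) := by
        refine mul_le_mul ?_ hdens hdens0 (by positivity)
        rw [hsizeq]; exact div_le_div_of_nonneg_right hNle (by positivity)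
      refine (mul_le_mul_of_nonneg_left h1 hK).trans ?_
      -- identify with `X₀`
      have hlogx : 0 < Real.log x := Real.log_pos hxgt1
      have hq' : (q : ℝ) = W * D := by rw [hq]; push_cast; ring
      have hB' : polymathB x = (Nat.totient W : ℝ) / W * Real.log x := rfl
      have hid : (2 * x / q) * (2 ^ ω D * (((W : ℝ) / Nat.totient W) * mertensC₀ / Real.log R) ^ k) =
          (2 * mertensC₀ ^ k * (40 * k) ^ k) * ((2 ^ ω D * ((Ω D : ℝ) + 1) ^ k) * (X₀ / D)) := by
        have hφ0 : (Nat.totient W : ℝ) ≠ 0 := hφpos.ne'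
        have hW0' : (W : ℝ) ≠ 0 := hWpos.ne'
        have hL0 : Real.log x ≠ 0 := hlogx.ne'
        have ht : ((W : ℝ) / Nat.totient W) * mertensC₀ / Real.log R =
            ((W : ℝ) * mertensC₀ * ((40 * k) * ((Ω D : ℝ) + 1))) / ((Nat.totient W : ℝ) * Real.log x) := by
          rw [hlogRe]; field_simp
        have htk : (((W : ℝ) * mertensC₀ * ((40 * k) * ((Ω D : ℝ) + 1))) / ((Nat.totient W : ℝ) * Real.log x)) ^ k =
            ((W : ℝ) ^ k * mertensC₀ ^ k * ((40 * k) ^ k * ((Ω D : ℝ) + 1) ^ k)) / ((Nat.totient W : ℝ) ^ k * Real.log x ^ k) := by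
          rw [div_pow, mul_pow, mul_pow, mul_pow, mul_pow, mul_pow]
        have hXD : X₀ / D = x * (W : ℝ) ^ k / ((Nat.totient W : ℝ) ^ k * Real.log x ^ k * W * D) := by
          rw [hX₀, hB', show (Nat.totient W : ℝ) / W * Real.log x = (Nat.totient W : ℝ) * Real.log x / W by ring, div_pow, mul_pow]
          field_simp
        rw [ht, htk, hXD, hq']
        field_simp
      rw [hid]
      have hωΩ : (2 : ℝ) ^ ω D * ((Ω D : ℝ) + 1) ^ k ≤ 2 ^ ((k + 1) * Ω D) := by
        have h2 : ((Ω D : ℝ) + 1) ≤ 2 ^ Ω D := by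
          have : Ω D + 1 ≤ 2 ^ Ω D := Nat.lt_two_pow_self
          exact_mod_cast this
        calc (2 : ℝ) ^ ω D * ((Ω D : ℝ) + 1) ^ k ≤ 2 ^ Ω D * (2 ^ Ω D) ^ k :=
              mul_le_mul (pow_le_pow_right₀ (by norm_num) (cardDistinctFactors_le_cardFactors D))
                (pow_le_pow_left₀ (by positivity) h2 k) (by positivity) (by positivity)
          _ = 2 ^ ((k + 1) * Ω D) := by rw [← pow_mul, ← pow_add]; congr 1; ring
      have hX₀D : 0 ≤ X₀ / D := by positivity
      calc (1 + 2 * dimConstK k ^ (10 : ℕ)) * ((2 * mertensC₀ ^ k * (40 * k) ^ k) * ((2 ^ ω D * ((Ω D : ℝ) + 1) ^ k) * (X₀ / D)))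
          ≤ (1 + 2 * dimConstK k ^ (10 : ℕ)) * ((2 * mertensC₀ ^ k * (40 * k) ^ k) * (2 ^ ((k + 1) * Ω D) * (X₀ / D))) := by
            have hm0 : 0 ≤ 2 * mertensC₀ ^ k * (40 * (k : ℝ)) ^ k := by have := mertensC₀_pos; positivity
            exact mul_le_mul_of_nonneg_left (mul_le_mul_of_nonneg_left (mul_le_mul_of_nonneg_right hωΩ hX₀D) hm0) hK
        _ = _ := by ring
    -- Step B5: the remainder
    have hrem : ∑ e ∈ P'.divisors.filter (fun e : ℕ => (e : ℝ) ≤ Dl), |A.remainder e Xv| ≤ x ^ (1 / 2 : ℝ) := by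
      have hterm : ∀ e ∈ P'.divisors.filter (fun e : ℕ => (e : ℝ) ≤ Dl), |A.remainder e Xv| ≤ Dl := by
        intro e he
        obtain ⟨he1, he2⟩ := Finset.mem_filter.1 he
        have he0 : 0 < e := Nat.pos_of_mem_divisors he1
        have hcop : q.Coprime e := hqP'.coprime_dvd_right (Nat.dvd_of_mem_divisors he1)
        calc |A.remainder e Xv| ≤ polyRootCountMod ![f] e := by rw [hA]; exact abs_remainder_polyAPSeq_le f hq0 he0 hcop hvals
          _ ≤ e := by exact_mod_cast polyRootCountMod_le _ _
          _ ≤ Dl := he2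
      have hcardF : ((P'.divisors.filter (fun e : ℕ => (e : ℝ) ≤ Dl)).card : ℝ) ≤ Dl := by
        have hsubI : P'.divisors.filter (fun e : ℕ => (e : ℝ) ≤ Dl) ⊆ Finset.Icc 1 ⌊Dl⌋₊ := by
          intro e he
          obtain ⟨he1, he2⟩ := Finset.mem_filter.1 he
          exact Finset.mem_Icc.2 ⟨Nat.pos_of_mem_divisors he1, Nat.le_floor he2⟩
        calc ((P'.divisors.filter (fun e : ℕ => (e : ℝ) ≤ Dl)).card : ℝ) ≤ (Finset.Icc 1 ⌊Dl⌋₊).card := by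
              exact_mod_cast Finset.card_le_card hsubI
          _ = ⌊Dl⌋₊ := by simp
          _ ≤ Dl := Nat.floor_le (by linarith)
      calc ∑ e ∈ P'.divisors.filter (fun e : ℕ => (e : ℝ) ≤ Dl), |A.remainder e Xv|
          ≤ ∑ _e ∈ P'.divisors.filter (fun e : ℕ => (e : ℝ) ≤ Dl), Dl := Finset.sum_le_sum hterm
        _ = (P'.divisors.filter (fun e : ℕ => (e : ℝ) ≤ Dl)).card * Dl := by rw [Finset.sum_const, nsmul_eq_mul]
        _ ≤ Dl * Dl := mul_le_mul_of_nonneg_right hcardF (by linarith)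
        _ = R ^ (18 * k + 2) := by rw [hDl, ← pow_add, show 9 * k + 1 + (9 * k + 1) = 18 * k + 2 by ring]
        _ ≤ x ^ (1 / 2 : ℝ) := by
            -- `R^{18k+2} = x^{(18k+2)/(40k(Ω+1))} ≤ x^{1/2}`
            rw [hRdef, ← Real.rpow_natCast, ← Real.rpow_mul hx0.le]
            refine Real.rpow_le_rpow_of_exponent_le hx1' ?_
            have hk1 : (1 : ℝ) ≤ k := by exact_mod_cast hk
            have hΩ0 : (0 : ℝ) ≤ Ω D := Nat.cast_nonneg _
            rw [div_mul_eq_mul_div, one_mul, div_le_iff₀ (by positivity)]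
            push_cast
            nlinarith
    -- Step B6: assemble
    refine hfinal _ (le_max_right _ _) ?_
    calc (S.card : ℝ) ≤ T.card := by exact_mod_cast hST
      _ = A.sifted Xv P' := hTcard
      _ ≤ _ := hsieve
      _ ≤ ((1 + 2 * dimConstK k ^ (10 : ℕ)) * 2 * mertensC₀ ^ k * (40 * k) ^ k) * (2 ^ ((k + 1) * Ω D) * X₀ / D) + x ^ (1 / 2 : ℝ) :=
          add_le_add hmain hrem

end AlmostPrimeSieve

end Literature.NumberTheory.Sieve
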